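/-
COR-CM (cell pub-hodgecm2, stage 2 of the Hodge ladder) — junction B01, O side: the PACKAGE RECORD SHAPE of hM.
COORDINATOR RULINGS — HODGE VENUE 2026-08-21T19:05:27Z ((3)(b)+: hM displayed in the tree in the consumed form and discharged BY RECORD
from the package kernel) and HM-EQUALITY Δ1–Δ3 OWNERS 19:17:21Z (Δ3 = the two `embOf` reconciliation → own-b01).  This file is own-b01ʼs
Δ3 resolution: a display whose per-face hypothesis is FIELD FOR FIELD the stage-1 packageʼs record `HodgeCM.Universe.ThetaRealisation₂`
(`HodgeCMPerL/HodgeCM/Model/EndStateMeet.lean` :120–156) under the port dictionary R1–R5 — with the wedge-function map `Λ` ABSTRACT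
(bilinear `H¹ × H¹ → HG`, as the package field is; no `emb`, no tree `Model.embOf`, no item-(iii) clause) and Petersson = period in the
packageʼs own `inner_Λ` PERIOD form (`U.H10 X` unfolded to `(U.hodge X 1).piece 1 0`, `Automorphic/Realisation.lean` :58) — so that the
packageʼs by-record fact `ModelAxiomsPerL.nonempty_thetaRealisation₂_at` (:353) instantiates it symbol for symbol and NO identification of
the two `embOf` constructions is needed.  Engine = PKG `thm44_of_realisation₂` (:200–222) verbatim over the ported Thm 3.7
(`Perl34.IsolationSetting.C2_S12_eq_S34`, p277743) — the tree twin `IsolationSpans.periodNV_ofSetting_meet` (p280226) spells `Λ Γ a b`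
as `emb Γ (a ∪ b)`; here `Λ` stays a datum.  Filed by the single owner of B01, prover-pub-hodgecm2-own-b01 (gen 2).  Theorems only; nothing
asserted; every binder below is OPEN in the tree (discharged in the package kernel modulo hGRU + μ + h418).  FRAMING: HC_CM is NOT proved.
-/
import Summits.HodgeConjecture.CorCM.B01.Transposition.AssemblyFree
import Summits.HodgeConjecture.CorCM.B01.Transposition.Item5IsolationSpansHolds
import HarnessLib

/-!
# The `ThetaRealisation₂` record shape of hM (Δ3): `Λ` abstract, `inner_Λ` in period form

* `Transposition.periodNV_of_thetaRealisation₂` — for any universe with `Fact_pull_hodge`: an isolation setting `S`, an abstract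
  wedge-function map `Λ`, theta sets `Theta ⊆ U_Ψ`, the line field, C5′ `gen12Meet`, C6′ `real34Meet` and `inner_Λ` (period form) give
  `U.PeriodNV ι₁ V K Ψ σ` — PKG `thm44_of_realisation₂`, Steps 1, 2′ (Thm 3.7 + `TorusData.S12_def` + closure-span lemma), 3′–4′, 5–6.
* `Model.hc_cm_of_thetaRealisation₂ (hHD hI h₁ h₃) (hR) (h)` and `Model.hc_cm_of_thetaRealisation₂_rec (h)` — `HC_CM` from, per Galois CM
  field `F` of degree `≥ 6` and face `f`, at SOME `(ι₁, V, σ)`, the field list of `ThetaRealisation₂` (via `hc_cm_of_exists_facePeriod_free`).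

Dictionary for the red teamʼs HM-EQUALITY check (tree ← package): `Summit.HodgeConjecture.CorCM.` ← `HodgeCM.` (R1), `Literature.X` ←
`HodgeCM.Vendored.H21.X` (R2), `Prior.Perl34File.Perl34.IsolationSetting` ← `Perl34.IsolationSetting` (tree port p277216/p275809),
`(U.hodge X 1).piece 1 0` ← `U.H10 X`; the per-face prefix `∀ F, IsGalois ℚ F → 6 ≤ finrank ℚ F → ∀ f : Face F, ∃ ι₁ V σ` ← the packageʼs
good face contexts `faceCtx F f ι₁ D` (`K = F`, `Ψ = f.psi`, `σ = ι₁`; here `σ` is left free, which only weakens the hypothesis).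
-/

noncomputable section

open scoped TensorProduct InnerProductSpace

namespace Summit.HodgeConjecture.CorCM

open Literature.AlgebraicGeometry.Motives (CMType HodgeStructure)
open Literature.AlgebraicGeometry.Motives.HodgeStructure (conj)
open Literature.AlgebraicGeometry.HodgeTheory
open Literature.NumberTheory.Automorphic
open Literature.NumberTheory.Automorphic.PicardCM
open Prior.Perl34File (Perl34.IsolationSetting)
open Prior.Perl34File.Perl34

namespace Transposition

variable {U : Universe} {L : CMField} {ι₁ : L →+* ℂ} {V : HermSpace3 L ι₁}
  {H HG CG G SK SigIdx SigIdxG : Type}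
  [NormedAddCommGroup H] [InnerProductSpace ℂ H] [CompleteSpace H]
  [NormedAddCommGroup HG] [InnerProductSpace ℂ HG] [CompleteSpace HG]
  [NormedAddCommGroup CG] [NormedSpace ℂ CG]
  [Group G] [TopologicalSpace G] [TopologicalSpace SK]

/-- **PKG `thm44_of_realisation₂` with the wedge-function map ABSTRACT** (`Model/EndStateMeet.lean` :200–222, field list of
`ThetaRealisation₂` :120–156 verbatim under R1–R5, `U.H10 X` unfolded): an isolation setting `S`, `Λ : H¹ × H¹ → HG` bilinear, theta
sets `Theta i Γ ⊆ U_{Ψ i}(Γ)`, the line field `Λ Γ ω₁ ω₂ ≠ 0`, C5′ `gen12Meet`, C6′ `real34Meet`, and `inner_Λ` (Petersson = period for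
`(1,0)`-classes) give a pure period witness.  Step 2′ uses Thm 3.7 `S₁₂ = S₃₄` (`Perl34.IsolationSetting.C2_S12_eq_S34`), `TorusData.S12_def`
and `exists_inner_ne_zero_of_mem_closure_span`; Steps 5–6 use `U_Ψ ⊆ H^{1,0}` (`Universe.Uiso_le_piece10`, the one universe fact) and
`Universe.periodNV_of_period_ne_zero`. [folklore] -/
theorem periodNV_of_thetaRealisation₂ (hH : U.Fact_pull_hodge) {K : CMField} {Ψ : Fin 4 → CMType K} {σ : K →+* ℂ}
    (S : Perl34.IsolationSetting H HG CG G SK SigIdx SigIdxG)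
    (Λ : ∀ Γ : Level V, U.CohC (U.pms L ι₁ V Γ) 1 →ₗ[ℂ] U.CohC (U.pms L ι₁ V Γ) 1 →ₗ[ℂ] HG)
    (Theta : Fin 4 → ∀ Γ : Level V, Set (U.CohC (U.pms L ι₁ V Γ) 1))
    (Theta_sub : ∀ (i : Fin 4) (Γ : Level V), Theta i Γ ⊆ U.Uiso Γ K (Ψ i) σ)
    (lineField : ∃ Γ : Level V, ∃ ω₁ ∈ Theta 0 Γ, ∃ ω₂ ∈ Theta 1 Γ, Λ Γ ω₁ ω₂ ≠ 0)
    (gen12Meet : ∀ (Γ : Level V) (ω₁ ω₂ : U.CohC (U.pms L ι₁ V Γ) 1),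
      ω₁ ∈ Theta 0 Γ → ω₂ ∈ Theta 1 Γ → Λ Γ ω₁ ω₂ ≠ 0 → ∃ u ∈ S.t12.S12, ⟪Λ Γ ω₁ ω₂, u⟫_ℂ ≠ 0)
    (real34Meet : ∀ χ : S.t34.X, S.t34.allowed χ → ∀ (Φ : SK) (Γ₁ : Level V) (ω₁ ω₂ : U.CohC (U.pms L ι₁ V Γ₁) 1),
      ω₁ ∈ U.Uiso Γ₁ K (Ψ 0) σ → ω₂ ∈ U.Uiso Γ₁ K (Ψ 1) σ → ⟪Λ Γ₁ ω₁ ω₂, S.t34.ϑ χ Φ⟫_ℂ ≠ 0 →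
      ∃ (Γ : Level V) (ω : Fin 4 → U.CohC (U.pms L ι₁ V Γ) 1),
        (∀ i, ω i ∈ U.Uiso Γ K (Ψ i) σ) ∧ ⟪Λ Γ (ω 2) (ω 3), Λ Γ (ω 0) (ω 1)⟫_ℂ ≠ 0)
    (inner_Λ : ∀ Γ : Level V, ∃ c : ℂ, c ≠ 0 ∧ ∀ ω : Fin 4 → U.CohC (U.pms L ι₁ V Γ) 1,
      (∀ i, ω i ∈ (U.hodge (U.pms L ι₁ V Γ) 1).piece 1 0) →
        ⟪Λ Γ (ω 2) (ω 3), Λ Γ (ω 0) (ω 1)⟫_ℂ = c * U.period (U.pms L ι₁ V Γ) ω) :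
    U.PeriodNV ι₁ V K Ψ σ := by
  -- Step 1: a non-zero theta (12)-wedge-function at some level Γ₁ (Prop 4.3)
  obtain ⟨Γ₁, ω₁, hω₁, ω₂, hω₂, hv⟩ := lineField
  -- Step 2′: not orthogonal to S₁₂ = S₃₄ (Thm 3.7), hence pairs non-trivially with some generator ϑ_{T′,χ}(Φ), χ allowed
  obtain ⟨u, huS, hu⟩ := gen12Meet Γ₁ ω₁ ω₂ hω₁ hω₂ hv
  rw [S.C2_S12_eq_S34, S.t34.S12_def] at huS
  obtain ⟨w, ⟨χ, hχ, Φ, rfl⟩, hw⟩ := exists_inner_ne_zero_of_mem_closure_span hu huS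
  -- Steps 3′–4′: reality-meeting at ONE level Γ
  obtain ⟨Γ, ω, hU, hinner⟩ := real34Meet χ hχ Φ Γ₁ ω₁ ω₂ (Theta_sub 0 Γ₁ hω₁) (Theta_sub 1 Γ₁ hω₂) hw
  -- Steps 5–6: Petersson = period, then multilinear expansion to pure pull-backs
  obtain ⟨c, -, hc⟩ := inner_Λ Γ
  have h10 : ∀ i, ω i ∈ (U.hodge (U.pms L ι₁ V Γ) 1).piece 1 0 :=
    fun i => Universe.Uiso_le_piece10 hH Γ K (Ψ i) σ (hU i)
  have hper : U.period (U.pms L ι₁ V Γ) ω ≠ 0 := by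
    intro h0
    apply hinner
    rw [hc ω h10, h0, mul_zero]
  exact Universe.periodNV_of_period_ne_zero Γ ω hU hper

end Transposition

namespace Model

open Transposition

/-- **hM in the PACKAGE RECORD SHAPE gives `HC_CM` on the model universe**: per Galois CM field `F` of degree `≥ 6` and face `f`, at
SOME `(ι₁, V, σ)`, the field list of `HodgeCM.Universe.ThetaRealisation₂` (isolation setting `S`, abstract `Λ`, `Theta`, `Theta_sub`,
`lineField`, `gen12Meet`, `real34Meet`, `inner_Λ`) — then `HC_CM`, by `periodNV_of_thetaRealisation₂` and `hc_cm_of_exists_facePeriod_free`.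
`hR` = Hom-fullness [Deligne–Milne 1982, Thm 6.20], a tree theorem on the universe of record.  The package supplies this hypothesis BY RECORD
(`ModelAxiomsPerL.nonempty_thetaRealisation₂_at`, modulo hGRU + μ + h418); in the tree it is OPEN. [folklore] -/
theorem hc_cm_of_thetaRealisation₂ (hHD : exists_isReal_hodgeModel) (hI : hodgePQ_independent_of_hodgeModel)
    (h₁ : BallQuotientUniformised) (h₃ : CMAbelianVarietyRealised) (hR : DeligneMilne1982_Thm_6_20_full)
    (h : ∀ (F : CMField), IsGalois ℚ F → 6 ≤ Module.finrank ℚ F → ∀ f : Face F,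
      ∃ (ι₁ : F →+* ℂ) (V : HermSpace3 F ι₁) (σ : F →+* ℂ)
        (H HG CG G SK SigIdx SigIdxG : Type)
        (_ : NormedAddCommGroup H) (_ : InnerProductSpace ℂ H) (_ : CompleteSpace H)
        (_ : NormedAddCommGroup HG) (_ : InnerProductSpace ℂ HG) (_ : CompleteSpace HG)
        (_ : NormedAddCommGroup CG) (_ : NormedSpace ℂ CG) (_ : Group G) (_ : TopologicalSpace G) (_ : TopologicalSpace SK)
        (S : Perl34.IsolationSetting H HG CG G SK SigIdx SigIdxG)
        (Λ : ∀ Γ : Level V, (picardCMUniverse hHD hI h₁ h₃).CohC ((picardCMUniverse hHD hI h₁ h₃).pms F ι₁ V Γ) 1 →ₗ[ℂ]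
          (picardCMUniverse hHD hI h₁ h₃).CohC ((picardCMUniverse hHD hI h₁ h₃).pms F ι₁ V Γ) 1 →ₗ[ℂ] HG)
        (Theta : Fin 4 → ∀ Γ : Level V,
          Set ((picardCMUniverse hHD hI h₁ h₃).CohC ((picardCMUniverse hHD hI h₁ h₃).pms F ι₁ V Γ) 1)),
        (∀ (i : Fin 4) (Γ : Level V), Theta i Γ ⊆ (picardCMUniverse hHD hI h₁ h₃).Uiso Γ F (f.psi i) σ) ∧
        (∃ Γ : Level V, ∃ ω₁ ∈ Theta 0 Γ, ∃ ω₂ ∈ Theta 1 Γ, Λ Γ ω₁ ω₂ ≠ 0) ∧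
        (∀ (Γ : Level V) (ω₁ ω₂ : (picardCMUniverse hHD hI h₁ h₃).CohC ((picardCMUniverse hHD hI h₁ h₃).pms F ι₁ V Γ) 1),
          ω₁ ∈ Theta 0 Γ → ω₂ ∈ Theta 1 Γ → Λ Γ ω₁ ω₂ ≠ 0 → ∃ u ∈ S.t12.S12, ⟪Λ Γ ω₁ ω₂, u⟫_ℂ ≠ 0) ∧
        (∀ χ : S.t34.X, S.t34.allowed χ → ∀ (Φ : SK) (Γ₁ : Level V)
          (ω₁ ω₂ : (picardCMUniverse hHD hI h₁ h₃).CohC ((picardCMUniverse hHD hI h₁ h₃).pms F ι₁ V Γ₁) 1),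
          ω₁ ∈ (picardCMUniverse hHD hI h₁ h₃).Uiso Γ₁ F (f.psi 0) σ →
          ω₂ ∈ (picardCMUniverse hHD hI h₁ h₃).Uiso Γ₁ F (f.psi 1) σ → ⟪Λ Γ₁ ω₁ ω₂, S.t34.ϑ χ Φ⟫_ℂ ≠ 0 →
          ∃ (Γ : Level V) (ω : Fin 4 → (picardCMUniverse hHD hI h₁ h₃).CohC ((picardCMUniverse hHD hI h₁ h₃).pms F ι₁ V Γ) 1),
            (∀ i, ω i ∈ (picardCMUniverse hHD hI h₁ h₃).Uiso Γ F (f.psi i) σ) ∧ ⟪Λ Γ (ω 2) (ω 3), Λ Γ (ω 0) (ω 1)⟫_ℂ ≠ 0) ∧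
        (∀ Γ : Level V, ∃ c : ℂ, c ≠ 0 ∧
          ∀ ω : Fin 4 → (picardCMUniverse hHD hI h₁ h₃).CohC ((picardCMUniverse hHD hI h₁ h₃).pms F ι₁ V Γ) 1,
          (∀ i, ω i ∈ ((picardCMUniverse hHD hI h₁ h₃).hodge ((picardCMUniverse hHD hI h₁ h₃).pms F ι₁ V Γ) 1).piece 1 0) →
            ⟪Λ Γ (ω 2) (ω 3), Λ Γ (ω 0) (ω 1)⟫_ℂ =
              c * (picardCMUniverse hHD hI h₁ h₃).period ((picardCMUniverse hHD hI h₁ h₃).pms F ι₁ V Γ) ω)) :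
    HC_CM := by
  refine hc_cm_of_exists_facePeriod_free hHD hI h₁ h₃ (fun F hG h6 f => ?_) hR
  obtain ⟨ι₁, V, σ, H, HG, CG, G, SK, SigIdx, SigIdxG, _, _, _, _, _, _, _, _, _, _, _, S, Λ, Theta,
    hsub, hlf, hg, hr, hin⟩ := h F hG h6 f
  exact ⟨ι₁, V, σ, periodNV_of_thetaRealisation₂
    (universeOf_fact_pull_hodge hHD hI (ballQuotientUniformisedDatum_of h₁) h₃) S Λ Theta hsub hlf hg hr hin⟩

/-- The same on the universe OF RECORD (the four `_holds` data and `deligneMilne1982_Thm_6_20_full_holds` plugged in; ONE hypothesis =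
the package record shape of hM per face).  `HC_CM` is NOT proved. [folklore] -/
theorem hc_cm_of_thetaRealisation₂_rec :
    let U := picardCMUniverse exists_isReal_hodgeModel_holds hodgePQ_independent_of_hodgeModel_holds
      BallQuotient.ballQuotientUniformised_holds cmAbelianVarietyRealised_holds
    (∀ (F : CMField), IsGalois ℚ F → 6 ≤ Module.finrank ℚ F → ∀ f : Face F,
      ∃ (ι₁ : F →+* ℂ) (V : HermSpace3 F ι₁) (σ : F →+* ℂ)
        (H HG CG G SK SigIdx SigIdxG : Type)
        (_ : NormedAddCommGroup H) (_ : InnerProductSpace ℂ H) (_ : CompleteSpace H)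
        (_ : NormedAddCommGroup HG) (_ : InnerProductSpace ℂ HG) (_ : CompleteSpace HG)
        (_ : NormedAddCommGroup CG) (_ : NormedSpace ℂ CG) (_ : Group G) (_ : TopologicalSpace G) (_ : TopologicalSpace SK)
        (S : Perl34.IsolationSetting H HG CG G SK SigIdx SigIdxG)
        (Λ : ∀ Γ : Level V, U.CohC (U.pms F ι₁ V Γ) 1 →ₗ[ℂ] U.CohC (U.pms F ι₁ V Γ) 1 →ₗ[ℂ] HG)
        (Theta : Fin 4 → ∀ Γ : Level V, Set (U.CohC (U.pms F ι₁ V Γ) 1)),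
        (∀ (i : Fin 4) (Γ : Level V), Theta i Γ ⊆ U.Uiso Γ F (f.psi i) σ) ∧
        (∃ Γ : Level V, ∃ ω₁ ∈ Theta 0 Γ, ∃ ω₂ ∈ Theta 1 Γ, Λ Γ ω₁ ω₂ ≠ 0) ∧
        (∀ (Γ : Level V) (ω₁ ω₂ : U.CohC (U.pms F ι₁ V Γ) 1),
          ω₁ ∈ Theta 0 Γ → ω₂ ∈ Theta 1 Γ → Λ Γ ω₁ ω₂ ≠ 0 → ∃ u ∈ S.t12.S12, ⟪Λ Γ ω₁ ω₂, u⟫_ℂ ≠ 0) ∧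
        (∀ χ : S.t34.X, S.t34.allowed χ → ∀ (Φ : SK) (Γ₁ : Level V) (ω₁ ω₂ : U.CohC (U.pms F ι₁ V Γ₁) 1),
          ω₁ ∈ U.Uiso Γ₁ F (f.psi 0) σ → ω₂ ∈ U.Uiso Γ₁ F (f.psi 1) σ → ⟪Λ Γ₁ ω₁ ω₂, S.t34.ϑ χ Φ⟫_ℂ ≠ 0 →
          ∃ (Γ : Level V) (ω : Fin 4 → U.CohC (U.pms F ι₁ V Γ) 1),
            (∀ i, ω i ∈ U.Uiso Γ F (f.psi i) σ) ∧ ⟪Λ Γ (ω 2) (ω 3), Λ Γ (ω 0) (ω 1)⟫_ℂ ≠ 0) ∧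
        (∀ Γ : Level V, ∃ c : ℂ, c ≠ 0 ∧ ∀ ω : Fin 4 → U.CohC (U.pms F ι₁ V Γ) 1,
          (∀ i, ω i ∈ (U.hodge (U.pms F ι₁ V Γ) 1).piece 1 0) →
            ⟪Λ Γ (ω 2) (ω 3), Λ Γ (ω 0) (ω 1)⟫_ℂ = c * U.period (U.pms F ι₁ V Γ) ω)) →
    HC_CM :=
  fun h ↦ hc_cm_of_thetaRealisation₂ _ _ _ _ deligneMilne1982_Thm_6_20_full_holds h

#print axioms hc_cm_of_thetaRealisation₂_rec

end Model

end Summit.HodgeConjecture.CorCM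

end
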